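import Summits.BirchSwinnertonDyer.BirchSwinnertonDyer.Theorems.GoldfeldAllTwistsTwoConverseTwinAdditivePrimeTwistSelmer
import Literature.NumberTheory.EllipticCurves.TwoIsogenyShaTwoTorsion
import Literature.NumberTheory.EllipticCurves.SelmerTrivialCorankProofs
import Summits.BirchSwinnertonDyer.BirchSwinnertonDyer.Theorems.GoldfeldAllTwistsTwoConverseTwinAdditiveReduction
import HarnessLib

set_option linter.dupNamespace false -- namespace `…BirchSwinnertonDyer.BirchSwinnertonDyer…` is the cell's (D-0017 nested layout)
set_option autoImplicit false

/-!
# Twin″ (item 19140) on the additive PRIME-TWIST family: a complete `2`-isogeny descent for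
# `49a1^{(−ℓ)}`, `ℓ ≡ 1 (mod 4)` prime and inert in `ℚ(√−7)`

Cell `bsd-goldfeld`, seat `bsd-goldfeld-s1p-c301` (gen 2); `--supports stmt-BirchSwinnertonDyer-19140`
(`Summit.BirchSwinnertonDyer.BirchSwinnertonDyer.Theses.GoldfeldAllTwistsTwoConverse.BSDTwoCMSevenAdditiveRankOne`,
twin″ = Miller's `BSD(W,2)` for the globally minimal CM curves with `2` split in the CM field, NOT good at
`2`, of analytic rank `1`; by `bsdTwoCMSevenAdditiveRankOne_of_twists` these are the minimal models of the
twists `49a1^{(d)}`, `d` squarefree, `d ≢ 1 (mod 4)`, of analytic rank one). PARTITION: types-the-object-of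
the open P2 cell `r1.addv.borel.split` on an INFINITE sub-family and shrinks `BSD(W,2)` there to a single
`2`-adic unit statement. HONEST FRAMING: nothing here proves `BSD(W,2)` for a single curve; BSD is not
proved by any of this.

## The family and the descent

For a squarefree integer `d` the twist `49a1^{(d)} = cm7.quadraticTwist d` is `ℚ`-isomorphic to the curve
in two-torsion normal form

  `E_d : y² = x³ + 21 d x² + 112 d² x`   (`twoTorsionModel_eq_smul_quadraticTwist`: `E_d = C₀ • cm7^{(d)}`,
  `C₀ = ⟨u = 1/2, r = 2d, 0, 0⟩`; `T = (0,0)` is the rational `2`-torsion point, `b (a² − 4b) = −784 d⁴`),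

so the tree's explicit `2`-isogeny Selmer sets apply (`TwoIsogenySelmerGroup*.lean`, Silverman X.4.9):
`S(a,b)` = descent on the divisors of `b = 112 d²`, `S'(a,b) = S(−2a, a² − 4b) = S(−42 d, −7 d²)`.
For the family of these two files, `d = −ℓ` with `ℓ` a prime, `ℓ ≡ 1 (mod 4)`, `(−7/ℓ) = −1` (i.e.
`ℓ` inert in `K = ℚ(√−7)`; the twists `49a1^{(−ℓ)}` have conductor `784 ℓ²`, additive reduction `I₄*` at
`2`, root number `−1`), the sibling file `…TwinAdditivePrimeTwistSelmer.lean` PROVES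
`S(−21ℓ, 112ℓ²) ⊆ {1, 2, 7, 14}` and `S'(−21ℓ, 112ℓ²) = S(42ℓ, −7ℓ²) ⊆ {1, −7}` (local arguments at `ℝ`,
at `ℓ` and at `7` only — no `2`-adic analysis is needed). This file draws the consequences:

* Hence `2^{dim S + dim S'} ≤ 8`, and the tree's exact count
  `2^{dim S + dim S'} = 2^{rank + 2} · #Ш(E')[φ̂] · #Ш(E)[φ]` (`two_pow_twoIsogenySelmerRank_add_eq`,
  Silverman X.4.2(a)) gives **`rank E_{−ℓ}(ℚ) ≤ 1` unconditionally**, and **if the rank is `1` then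
  `Ш(E')[φ̂] = Ш(E)[φ] = 0`, so `Ш(E_{−ℓ}/ℚ)[2] = 0`** (`forall_mem_sha_two_smul_eq_zero_of_halfModel`,
  `φ̂ ∘ φ = [2]`), transported to every `ℚ`-isomorphic model (`rank_le_one_primeTwist`,
  `forall_mem_sha_two_smul_eq_zero_primeTwist`).
* Consequences for the ITEM (`bsdp_two_iff_shaAn_unit_primeTwist`): for every `W/ℚ` with
  `C • W = cm7.quadraticTwist (−ℓ)` of analytic rank `1`, granted only Gross–Zagier–Kolyvagin
  (`hGZK : rank_eq_analyticRank_of_analyticRank_le_one`, rank `= 1`): `Ш(W)[2^∞] = 0`,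
  `corank_{ℤ₂} Sel_{2^∞}(W) = 1` (so the HYPOTHESIS of the rank-one `2`-converse K12₂″, item 20044, holds
  on this family), and

    `BSD(W,2) ⟺ ∃ q : ℚ, #Ш_an(W) = q ∧ ord₂ q = 0`,

  i.e. on this infinite sub-family of the additive cell twin″ IS the statement "`#Ш_an = L'(E,1)·4/(Ω·R·16)`
  is a `2`-adic unit" (`∏ c = c₂ c₇ c_ℓ = 4·2·2`, `#E(ℚ)_tors = 2`), with the algebraic side `Ш[2^∞] = 0`
  SETTLED. Numerically (seat gen 0, kit j248486/j248731) every resolved curve of the family with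
  `|d| ≤ 3000` has `#Ш_an = 1` or `9`.

What is NOT here: the `2`-adic unit statement itself (the exact `2`-divisibility of the Heegner point —
the new mathematics of LINE T, TWINPP-LEAF.md §5); the sibling families `−2ℓ` (needs two `2`-adic local
lemmas) and split `ℓ` (where `S = {1, 7, 2ℓ, 14ℓ}`); the root number / parity route to `rank = 1` without
`r_an = 1`.

## References

* J. H. Silverman, *The Arithmetic of Elliptic Curves*, 2nd ed. (2009), Prop. X.4.9, Thm. X.4.2(a),
  Example X.4.10. [SilvermanAEC2009]
* D. Zywina, *There are infinitely many elliptic curves over the rationals of rank 2*, arXiv:2502.01957,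
  Lemmas 3.1–3.3 (the local lemmas reused from `Zywina2025RankTwo.lean`). [Zywina2025]
* B. H. Gross, *Arithmetic on Elliptic Curves with Complex Multiplication*, LNM 776 (1980), §§22–24
  (descents on the twists of `A(7) = X₀(49)`). [Gross1980LNM776]
* R. L. Miller, *Proving the Birch and Swinnerton-Dyer conjecture for specific elliptic curves of
  analytic rank zero and one*, LMS J. Comput. Math. 14 (2011), Def. 1.1. [Miller2011LMS]

## Design

Theorems only (no `def`, no named fact, no `instance`/`notation`). The curve is written literally as
`⟨0, ((-21 * ℓ : ℤ) : ℚ), 0, ((112 * ℓ ^ 2 : ℤ) : ℚ), 0⟩`, the shape the Selmer library is keyed to; the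
arithmetic core `2^{r+2} n₁ n₂ ≤ 8 ⇒ r ≤ 1 ∧ (r = 1 → n₁ = n₂ = 1)` is isolated so that the huge subgroup
terms are matched by unification, and transports along equalities of curves go through small
`subst` lemmas (instance arguments are propositions). `ℓ` is carried as `[Fact ℓ.Prime]` because
`legendreSym` needs it.
-/


noncomputable section

open scoped Classical

open WeierstrassCurve Literature.NumberTheory.EllipticCurves

namespace Summit.BirchSwinnertonDyer.BirchSwinnertonDyer.Theorems.GoldfeldGoodTwists

/-! ## §4. Counting: `rank ≤ 1`, and `rank = 1 ⇒ Ш[φ] = Ш'[φ̂] = 0 ⇒ Ш[2] = 0` -/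

/-- Arithmetic core: `k = 2^{r+2} n₁ n₂ ≤ 8` with `k > 0` forces `r ≤ 1`, and `n₁ = n₂ = 1` if `r = 1`.
[folklore] -/
private theorem rank_le_one_arith {r n₁ n₂ k : ℕ} (hk : k = 2 ^ (r + 2) * (n₁ * n₂)) (hk8 : k ≤ 8)
    (hkpos : 0 < k) : r ≤ 1 ∧ (r = 1 → n₁ = 1 ∧ n₂ = 1) := by
  subst hk
  have hn₁ : 0 < n₁ := Nat.pos_of_ne_zero (by rintro rfl; simp at hkpos)
  have hn₂ : 0 < n₂ := Nat.pos_of_ne_zero (by rintro rfl; simp at hkpos)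
  have h2 : 2 ^ (r + 2) ≤ 8 :=
    le_trans (Nat.le_mul_of_pos_right _ (Nat.mul_pos hn₁ hn₂)) hk8
  refine ⟨?_, fun hr => ?_⟩
  · by_contra hr
    have h16 : 2 ^ 4 ≤ 2 ^ (r + 2) := Nat.pow_le_pow_right (by norm_num) (by omega)
    omega
  · subst hr
    norm_num at hk8
    constructor <;> nlinarith

/-- **The descent count read off** (Silverman X.4.2(a) for `φ` and `φ̂`, tree
`two_pow_twoIsogenySelmerRank_add_eq`: `2^{dim S + dim S'} = 2^{rank+2} · #Ш(V₀)[Ξ] · #Ш(E)[Ξ]` with `V₀`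
the half-model of `E'`): if `#S(a,b) ≤ 4` and `#S'(a,b) ≤ 2` then `rank E_{a,b}(ℚ) ≤ 1`, and if the rank
is `1` both `φ`-parts of `Ш` vanish. [cite: SilvermanAEC2009, Thm. X.4.2(a) and Prop. X.4.9] -/
theorem rank_le_one_and_sha_parts_of_card_le {a b : ℤ} (hab : b * (a ^ 2 - 4 * b) ≠ 0)
    [hV₀ : (⟨0, -(a : ℚ) / 2, 0, ((a : ℚ) ^ 2 - 4 * b) / 16, 0⟩ : WeierstrassCurve ℚ).IsElliptic]
    [hE : (⟨0, (a : ℚ), 0, (b : ℚ), 0⟩ : WeierstrassCurve ℚ).IsElliptic]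
    (hS : (twoIsogenySelmerGroup a b).card ≤ 4) (hS' : (twoIsogenySelmerGroup' a b).card ≤ 2) :
    (⟨0, (a : ℚ), 0, (b : ℚ), 0⟩ : WeierstrassCurve ℚ).mordellWeilRank ≤ 1 ∧
      ((⟨0, (a : ℚ), 0, (b : ℚ), 0⟩ : WeierstrassCurve ℚ).mordellWeilRank = 1 →
        (⟨0, -(a : ℚ) / 2, 0, ((a : ℚ) ^ 2 - 4 * b) / 16, 0⟩ : WeierstrassCurve ℚ).sha ⊓
            (⟨0, -(a : ℚ) / 2, 0, ((a : ℚ) ^ 2 - 4 * b) / 16, 0⟩ :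
              WeierstrassCurve ℚ).twoIsogenyTorsorHom.range = ⊥ ∧
          (⟨0, (a : ℚ), 0, (b : ℚ), 0⟩ : WeierstrassCurve ℚ).sha ⊓
            (⟨0, (a : ℚ), 0, (b : ℚ), 0⟩ : WeierstrassCurve ℚ).twoIsogenyTorsorHom.range = ⊥) := by
  have key := two_pow_twoIsogenySelmerRank_add_eq hab
  have h1 : 2 ^ twoIsogenySelmerRank a b ≤ 4 := by
    rw [two_pow_twoIsogenySelmerRank_eq_card hab]; exact hS
  have h2 : 2 ^ twoIsogenySelmerRank' a b ≤ 2 := by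
    rw [two_pow_twoIsogenySelmerRank'_eq_card hab]; exact hS'
  have h8 : 2 ^ (twoIsogenySelmerRank a b + twoIsogenySelmerRank' a b) ≤ 8 := by
    rw [pow_add]; exact Nat.mul_le_mul h1 h2
  obtain ⟨hr, hparts⟩ := rank_le_one_arith key h8 (by positivity)
  exact ⟨hr, fun h => by
    obtain ⟨h₁, h₂⟩ := hparts h
    exact ⟨AddSubgroup.eq_bot_of_card_eq _ h₁, AddSubgroup.eq_bot_of_card_eq _ h₂⟩⟩

/-- The discriminant condition for `E_{−ℓ}`: `b (a² − 4b) = 112ℓ² · (−7ℓ²) ≠ 0`. [folklore] -/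
theorem hab_primeTwist {l : ℕ} (hl : l.Prime) :
    (112 * l ^ 2 : ℤ) * ((-21 * l) ^ 2 - 4 * (112 * l ^ 2)) ≠ 0 := by
  have hl0 : (l : ℤ) ≠ 0 := by exact_mod_cast hl.ne_zero
  rw [show ((-21 * l : ℤ) ^ 2 - 4 * (112 * l ^ 2)) = -7 * l ^ 2 by ring]
  exact mul_ne_zero (by positivity) (mul_ne_zero (by norm_num) (pow_ne_zero 2 hl0))

/-- **`rank E_{−ℓ}(ℚ) ≤ 1`, and `rank = 1 ⇒ Ш(E_{−ℓ}/ℚ)[2] = 0`**, for `E_{−ℓ} : y² = x³ − 21ℓx² + 112ℓ²x`,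
`ℓ ≡ 1 (mod 4)` prime with `(−7/ℓ) = −1` — the complete `2`-isogeny descent (`#S ≤ 4`, `#S' ≤ 2`,
`2^{dim S + dim S'} = 2^{rank+2} #Ш(E')[φ̂] #Ш(E)[φ]`, `φ̂ ∘ φ = [2]`). UNCONDITIONAL.
[cite: SilvermanAEC2009, Thm. X.4.2(a), Prop. X.4.9] -/
theorem rank_le_one_and_sha_two_twoTorsionModel_primeTwist {l : ℕ} [Fact l.Prime] (hl4 : l % 4 = 1)
    (hl7 : legendreSym l (-7) = -1)
    [hE : (⟨0, ((-21 * l : ℤ) : ℚ), 0, ((112 * l ^ 2 : ℤ) : ℚ), 0⟩ : WeierstrassCurve ℚ).IsElliptic] :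
    (⟨0, ((-21 * l : ℤ) : ℚ), 0, ((112 * l ^ 2 : ℤ) : ℚ), 0⟩ : WeierstrassCurve ℚ).mordellWeilRank ≤ 1 ∧
      ((⟨0, ((-21 * l : ℤ) : ℚ), 0, ((112 * l ^ 2 : ℤ) : ℚ), 0⟩ : WeierstrassCurve ℚ).mordellWeilRank = 1 →
        ∀ c ∈ (⟨0, ((-21 * l : ℤ) : ℚ), 0, ((112 * l ^ 2 : ℤ) : ℚ), 0⟩ : WeierstrassCurve ℚ).sha,
          2 • c = 0 → c = 0) := by
  have hl : l.Prime := Fact.out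
  have hab := hab_primeTwist hl
  haveI := isElliptic_halfModel hab
  have hS : (twoIsogenySelmerGroup (-21 * l) (112 * l ^ 2)).card ≤ 4 :=
    le_trans (Finset.card_le_card fun d hd => mem_of_mem_twoIsogenySelmerGroup_primeTwist hl7 hd)
      Finset.card_le_four
  have hS' : (twoIsogenySelmerGroup' (-21 * l) (112 * l ^ 2)).card ≤ 2 :=
    le_trans (Finset.card_le_card fun d hd =>
      mem_of_mem_twoIsogenySelmerGroup'_primeTwist hl4 hl7 hd) Finset.card_le_two
  obtain ⟨hr, hparts⟩ := rank_le_one_and_sha_parts_of_card_le hab hS hS'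
  refine ⟨hr, fun h => ?_⟩
  obtain ⟨h₀, h₁⟩ := hparts h
  exact forall_mem_sha_two_smul_eq_zero_of_halfModel h₀ h₁

/-! ## §5. The model: `E_d = C₀ • 49a1^{(d)}`, and transport to every `ℚ`-isomorphic model -/

/-- **`E_d : y² = x³ + 21d x² + 112d² x` is `ℚ`-isomorphic to the twist `49a1^{(d)}`**: with
`C₀ = ⟨u = 1/2, r = 2d, s = 0, t = 0⟩`, `C₀ • cm7.quadraticTwist d = E_d` (`cm7^{(d)} : y² = x³ − (3d/4)x²
− 2d² x − d³`; the `2`-torsion point `x = 2d` is moved to the origin and the model scaled by `u = 1/2`).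
[cite: SilvermanAEC2009, III.1 (admissible changes of variables) and X.5 Cor. 5.4] -/
theorem twoTorsionModel_eq_smul_quadraticTwist (d : ℚ) :
    (⟨(Units.mk0 (2 : ℚ) two_ne_zero)⁻¹, 2 * d, 0, 0⟩ : VariableChange ℚ) • cm7.quadraticTwist d =
      ⟨0, 21 * d, 0, 112 * d ^ 2, 0⟩ := by
  ext
  · simp [variableChange_a₁]
  · simp only [variableChange_a₂, quadraticTwist_a₁, quadraticTwist_a₂, inv_inv, Units.val_mk0, b₂]
    norm_num; ring
  · simp [variableChange_a₃]
  · simp only [variableChange_a₄, quadraticTwist_a₁, quadraticTwist_a₂, quadraticTwist_a₃,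
      quadraticTwist_a₄, inv_inv, Units.val_mk0, b₂, b₄]
    norm_num; ring
  · simp only [variableChange_a₆, quadraticTwist_a₁, quadraticTwist_a₂, quadraticTwist_a₃,
      quadraticTwist_a₄, quadraticTwist_a₆, inv_inv, Units.val_mk0, b₂, b₄, b₆]
    norm_num; ring

/-- For `C • W = cm7.quadraticTwist (−ℓ)`: `(C₀ * C) • W = E_{−ℓ}` literally. [folklore] -/
theorem smul_eq_twoTorsionModel_primeTwist {l : ℕ} (W : WeierstrassCurve ℚ) (C : VariableChange ℚ)
    (hC : C • W = cm7.quadraticTwist ((-l : ℤ) : ℚ)) :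
    ((⟨(Units.mk0 (2 : ℚ) two_ne_zero)⁻¹, 2 * ((-l : ℤ) : ℚ), 0, 0⟩ : VariableChange ℚ) * C) • W =
      ⟨0, ((-21 * l : ℤ) : ℚ), 0, ((112 * l ^ 2 : ℤ) : ℚ), 0⟩ := by
  rw [mul_smul, hC, twoTorsionModel_eq_smul_quadraticTwist]
  ext <;> push_cast <;> ring

/-- Transport of the rank along an equality of curves (the instances are propositions). [folklore] -/
theorem mordellWeilRank_congr {X Y : WeierstrassCurve ℚ} (h : X = Y) [X.IsElliptic]
    [Y.IsElliptic] : X.mordellWeilRank = Y.mordellWeilRank := by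
  subst h
  rfl

/-- Transport of "`Ш` has no `2`-torsion" along an equality of curves. [folklore] -/
theorem forall_mem_sha_two_congr {X Y : WeierstrassCurve ℚ} (h : X = Y)
    (hY : ∀ c ∈ Y.sha, 2 • c = 0 → c = 0) : ∀ c ∈ X.sha, 2 • c = 0 → c = 0 := by
  subst h
  exact hY

/-- "`Ш` has no `n`-torsion" ⇔ `Ш ⊓ H¹[n] = ⊥` (bookkeeping). [folklore] -/
theorem forall_mem_sha_iff_inf_torsionBy_eq_bot (W : WeierstrassCurve ℚ) (n : ℕ) :
    (∀ c ∈ W.sha, n • c = 0 → c = 0) ↔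
      (W.sha ⊓ AddSubgroup.torsionBy W.galH1 n : AddSubgroup W.galH1) = ⊥ := by
  constructor
  · intro h
    refine eq_bot_iff.mpr fun c hc => ?_
    rw [AddSubgroup.mem_inf] at hc
    exact AddSubgroup.mem_bot.mpr (h _ hc.1 ((AddSubgroup.torsionBy.nsmul_iff (n := n)).mp hc.2))
  · intro h c hc hn
    have : c ∈ (W.sha ⊓ AddSubgroup.torsionBy W.galH1 n : AddSubgroup W.galH1) :=
      AddSubgroup.mem_inf.mpr ⟨hc, (AddSubgroup.torsionBy.nsmul_iff (n := n)).mpr hn⟩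
    rw [h] at this
    exact AddSubgroup.mem_bot.mp this

/-- "`Ш` has no `2`-torsion" passes from `C • W` back to `W` (the tree's `galH1Equiv`,
`sha_inf_torsionBy_eq_bot_smul`, applied to `C⁻¹`). [cite: SilvermanAEC2009, X.§4] -/
theorem forall_mem_sha_two_of_smul (W : WeierstrassCurve ℚ) (C : VariableChange ℚ)
    (h : ∀ c ∈ (C • W).sha, 2 • c = 0 → c = 0) : ∀ c ∈ W.sha, 2 • c = 0 → c = 0 := by
  have h1 := (forall_mem_sha_iff_inf_torsionBy_eq_bot (C • W) 2).mp h
  have h2 := sha_inf_torsionBy_eq_bot_smul (C • W) C⁻¹ 2 h1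
  exact forall_mem_sha_two_congr (inv_smul_smul C W).symm
    ((forall_mem_sha_iff_inf_torsionBy_eq_bot _ 2).mpr h2)

/-- **UNCONDITIONAL: `rank W(ℚ) ≤ 1` for every model `W` of `49a1^{(−ℓ)}`**, `ℓ ≡ 1 (mod 4)` prime,
`(−7/ℓ) = −1`. [cite: SilvermanAEC2009, Thm. X.4.2(a), Prop. X.4.9] -/
theorem rank_le_one_primeTwist {l : ℕ} [Fact l.Prime] (hl4 : l % 4 = 1)
    (hl7 : legendreSym l (-7) = -1) (W : WeierstrassCurve ℚ) [W.IsElliptic] (C : VariableChange ℚ)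
    (hC : C • W = cm7.quadraticTwist ((-l : ℤ) : ℚ)) : W.mordellWeilRank ≤ 1 := by
  have hl : l.Prime := Fact.out
  have hE := smul_eq_twoTorsionModel_primeTwist W C hC
  haveI := isElliptic_mk_of_ne_zero (F := ℚ) (hab_primeTwist hl)
  rw [← mordellWeilRank_variableChange_holds W
      ((⟨(Units.mk0 (2 : ℚ) two_ne_zero)⁻¹, 2 * ((-l : ℤ) : ℚ), 0, 0⟩ : VariableChange ℚ) * C),
    mordellWeilRank_congr hE]
  exact (rank_le_one_and_sha_two_twoTorsionModel_primeTwist hl4 hl7).1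

/-- **`rank W(ℚ) = 1 ⇒ Ш(W/ℚ)[2] = 0`** for every model `W` of `49a1^{(−ℓ)}` (same `ℓ`). UNCONDITIONAL.
[cite: SilvermanAEC2009, Thm. X.4.2(a), Prop. X.4.9, Thm. III.6.2(a)] -/
theorem forall_mem_sha_two_smul_eq_zero_primeTwist {l : ℕ} [Fact l.Prime] (hl4 : l % 4 = 1)
    (hl7 : legendreSym l (-7) = -1) (W : WeierstrassCurve ℚ) [W.IsElliptic] (C : VariableChange ℚ)
    (hC : C • W = cm7.quadraticTwist ((-l : ℤ) : ℚ)) (hr : W.mordellWeilRank = 1) :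
    ∀ c ∈ W.sha, 2 • c = 0 → c = 0 := by
  have hl : l.Prime := Fact.out
  have hE := smul_eq_twoTorsionModel_primeTwist W C hC
  haveI := isElliptic_mk_of_ne_zero (F := ℚ) (hab_primeTwist hl)
  have hr' : (⟨0, ((-21 * l : ℤ) : ℚ), 0, ((112 * l ^ 2 : ℤ) : ℚ), 0⟩ :
      WeierstrassCurve ℚ).mordellWeilRank = 1 := by
    rw [← mordellWeilRank_congr hE, mordellWeilRank_variableChange_holds]; exact hr
  exact forall_mem_sha_two_of_smul W _
    (forall_mem_sha_two_congr hE ((rank_le_one_and_sha_two_twoTorsionModel_primeTwist hl4 hl7).2 hr'))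

/-! ## §6. Consequences for twin″ (item 19140) and K12₂″ (item 20044) on the family -/

/-- **`BSD(W,2)` when `Ш(W)[2^∞] = 0` and `rank = r_an`**: Miller's `BSD(W,2)` (tree `BSDp W 2`) is then
exactly "`#Ш_an(W)` is a rational number of `2`-adic valuation `0`". [cite: Miller2011LMS, Def. 1.1] -/
theorem bsdp_two_iff_of_primaryComponent_eq_bot (W : WeierstrassCurve ℚ)
    (hbot : AddCommGroup.primaryComponent W.sha 2 = ⊥) (hrank : W.mordellWeilRank = W.analyticRank) :
    BSDp W 2 ↔ ∃ q : ℚ, shaAn W = (q : ℂ) ∧ padicValRat 2 q = 0 := by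
  have hfin : Finite (AddCommGroup.primaryComponent W.sha 2) := by rw [hbot]; infer_instance
  have hcard : Nat.card (AddCommGroup.primaryComponent W.sha 2) = 1 := by
    rw [hbot]; exact AddSubgroup.card_bot
  rw [bsdp_iff]
  simp only [hrank, hfin, hcard, padicValNat_one_right, Nat.cast_zero, true_and]

/-- **Twin″ on the prime-twist family `49a1^{(−ℓ)}`, `ℓ ≡ 1 (mod 4)` prime inert in `ℚ(√−7)`.** For every
model `W/ℚ` of such a twist (`C • W = cm7.quadraticTwist (−ℓ)`) of analytic rank `1`, granted
Gross–Zagier–Kolyvagin (`hGZK`, giving `rank W(ℚ) = 1`): (i) `rank W(ℚ) = 1`; (ii) `Ш(W/ℚ)[2^∞] = 0`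
(the complete `2`-descent of this file); (iii) `corank_{ℤ₂} Sel_{2^∞}(W/ℚ) = 1` (the hypothesis of K12₂″
holds); (iv) **`BSD(W,2) ⟺ #Ш_an(W) ∈ ℚ` has `ord₂ = 0`** — on this infinite sub-family of the additive cell
the item `BSDTwoCMSevenAdditiveRankOne` is reduced to ONE `2`-adic unit statement about
`L'(E,1)/(Ω·Reg)`, its algebraic side being settled. [cite: SilvermanAEC2009, Thm. X.4.2(a), Prop. X.4.9]
[cite: Miller2011LMS, Def. 1.1] [cite: Greenberg1999LNM, §1 pp. 54–57] -/
theorem bsdp_two_iff_shaAn_unit_primeTwist (hGZK : rank_eq_analyticRank_of_analyticRank_le_one)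
    {l : ℕ} [Fact l.Prime] (hl4 : l % 4 = 1) (hl7 : legendreSym l (-7) = -1)
    (W : WeierstrassCurve ℚ) [W.IsElliptic] (C : VariableChange ℚ)
    (hC : C • W = cm7.quadraticTwist ((-l : ℤ) : ℚ)) (har : W.analyticRank = 1) :
    W.mordellWeilRank = 1 ∧ AddCommGroup.primaryComponent W.sha 2 = ⊥ ∧ W.selmerCorank 2 = 1 ∧
      (BSDp W 2 ↔ ∃ q : ℚ, shaAn W = (q : ℂ) ∧ padicValRat 2 q = 0) := by
  haveI : Fact (Nat.Prime 2) := ⟨Nat.prime_two⟩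
  have hrank : W.mordellWeilRank = W.analyticRank := (hGZK W (by rw [har])).1
  have hr : W.mordellWeilRank = 1 := by rw [hrank, har]
  have h2 := forall_mem_sha_two_smul_eq_zero_primeTwist hl4 hl7 W C hC hr
  have hbot := W.primaryComponent_sha_eq_bot_of_forall h2
  refine ⟨hr, hbot, ?_, bsdp_two_iff_of_primaryComponent_eq_bot W hbot hrank⟩
  rw [W.selmerCorank_eq_mordellWeilRank_add_holds 2, hr, W.shaCorank_eq_zero_of_forall 2 h2]

/-- **The item's instances on the family, from the unit statement.** If `#Ш_an` is a `2`-adic unit for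
every analytic-rank-one model of `49a1^{(−ℓ)}` (`ℓ ≡ 1 (mod 4)` prime, `(−7/ℓ) = −1`), then `BSD(W,2)`
holds for all of them (granted `hGZK`) — the `d = −ℓ` instances of the twist form of twin″
(`bsdTwoCMSevenAdditiveRankOne_of_twists`). [cite: Miller2011LMS, Def. 1.1] -/
theorem bsdp_two_primeTwist_of_shaAn_unit (hGZK : rank_eq_analyticRank_of_analyticRank_le_one)
    (hunit : ∀ (l : ℕ) [Fact l.Prime], l % 4 = 1 → legendreSym l (-7) = -1 →
      ∀ (W : WeierstrassCurve ℚ) [W.IsElliptic] (C : VariableChange ℚ),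
        C • W = cm7.quadraticTwist ((-l : ℤ) : ℚ) → W.analyticRank = 1 →
        ∃ q : ℚ, shaAn W = (q : ℂ) ∧ padicValRat 2 q = 0)
    {l : ℕ} [Fact l.Prime] (hl4 : l % 4 = 1) (hl7 : legendreSym l (-7) = -1)
    (W : WeierstrassCurve ℚ) [W.IsElliptic] (C : VariableChange ℚ)
    (hC : C • W = cm7.quadraticTwist ((-l : ℤ) : ℚ)) (har : W.analyticRank = 1) : BSDp W 2 :=
  (bsdp_two_iff_shaAn_unit_primeTwist hGZK hl4 hl7 W C hC har).2.2.2.mpr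
    (hunit l hl4 hl7 W C hC har)

end Summit.BirchSwinnertonDyer.BirchSwinnertonDyer.Theorems.GoldfeldGoodTwists

end
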